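import Mathlib
import Summits.Ventures.PercRepro2.Defs
import Summits.Ventures.PercRepro2.Graph
import Summits.Ventures.PercRepro2.OneColourSwitch
import Summits.Ventures.PercRepro2.RegionHubSign
import Summits.Ventures.PercRepro2.SideSwitch
import Summits.Ventures.PercRepro2.SideSwitchFibre
import Summits.Ventures.PercRepro2.SideSwitchMono
import Summits.Ventures.PercRepro2.SideSwitchM9
import Summits.Ventures.PercRepro2.SideSwitchClosed
import Summits.Ventures.PercRepro2.SideSwitchComps
import Summits.Ventures.PercRepro2.TermSwitchDefs
import Summits.Ventures.PercRepro2.TermSwitchFibre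
import Summits.Ventures.PercRepro2.TermSwitchCompsFibre
import Summits.Ventures.PercRepro2.TermSwitchMono
import Summits.Ventures.PercRepro2.TermSwitchM9
import Summits.Ventures.PercRepro2.TermSwitchRestrict
import Summits.Ventures.PercRepro2.TermSwitchHalfCube

/-!
# The corner-free half-cube inequality (blind cell PercRepro2, p3 g38, 2026-08-29;
`proofs/P3-POCKETRK.md` §8‴) — part A, the combinatorics

For a finset `A`, `R ⊆ A`, `S ⊆ A ∖ R` and a monotone non-negative `G : Finset α → ℤ`,
`Σ_{T ⊆ A ∖ R, ¬ S ⊆ T} (G T − G (A ∖ T)) ≤ 0` (`sum_corner_nonpos`): the complement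
`T ↦ A ∖ T` maps the index set onto `{T' ⊆ A : R ⊆ T', T' ∩ S ≠ ∅}` (`sum_compl_corner`) and
the injection `T ↦ T ∪ R` (`∪ S` when `T ∩ S = ∅`) into the same set dominates `G T` termwise
(`sum_le_sum_corner`).  Applied to the per-representative function `G T = 1[p ~_Y q at ρ_T] +
1[p ~_Y q at ρ^O_T]` of the half-cube theorem (`G_mono_nonneg`): for a representative `ρ`, a
set `R` of its components and a set `S` of components disjoint from `R`,
`Σ_{T ⊆ compsH ρ ∖ R, ¬ S ⊆ T} (σ_pq(ρ_T) + σ_pq(ρ^O_T)) ≤ 0` (`corner_sum_nonpos`) — the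
half-cube `{T : R ∩ T = ∅}` with the corner `{T ⊇ S}` removed.  Part B
(`TermSwitchCornerCubeSum`) turns it into the terminal-set theorem with the two conditions
`x₀ ∈ K_H` and `∃ x ∈ X₁, x ∈ K_H`.  Own work; std axioms.
-/

namespace Summit.Ventures.PercRepro2

namespace TermSwitch

open Finset Classical RegionHub OneColourSwitch SideSwitch

variable {V : Type*} {E : Type*}

section Combinatorics

variable {α : Type*} [DecidableEq α]

/-- The complement `T ↦ A ∖ T` maps `{T ⊆ A ∖ R : ¬ S ⊆ T}` onto `{T' ⊆ A : R ⊆ T' ∧ T' ∩ S ≠ ∅}`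
(for `R ⊆ A`, `S ⊆ A ∖ R`): the sum of `G (A ∖ T)` over the first is the sum of `G` over the
second. -/
lemma sum_compl_corner (A R S : Finset α) (hR : R ⊆ A) (hS : S ⊆ A \ R)
    (G : Finset α → ℤ) :
    ∑ T ∈ (A \ R).powerset.filter (fun T => ¬ S ⊆ T), G (A \ T) =
      ∑ T ∈ A.powerset.filter (fun T => R ⊆ T ∧ (T ∩ S).Nonempty), G T := by
  refine Finset.sum_nbij' (fun T => A \ T) (fun T => A \ T) ?_ ?_ ?_ ?_ ?_
  · intro T hT
    simp only [Finset.mem_filter, Finset.mem_powerset] at hT ⊢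
    obtain ⟨hTA, hST⟩ := hT
    refine ⟨Finset.sdiff_subset, ?_, ?_⟩
    · intro x hx
      exact Finset.mem_sdiff.2 ⟨hR hx, fun hxT => (Finset.mem_sdiff.1 (hTA hxT)).2 hx⟩
    · obtain ⟨x, hxS, hxT⟩ := Finset.not_subset.1 hST
      exact ⟨x, Finset.mem_inter.2 ⟨Finset.mem_sdiff.2 ⟨(Finset.mem_sdiff.1 (hS hxS)).1, hxT⟩,
        hxS⟩⟩
  · intro T hT
    simp only [Finset.mem_filter, Finset.mem_powerset] at hT ⊢
    obtain ⟨hTA, hRT, ⟨x, hx⟩⟩ := hT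
    refine ⟨?_, ?_⟩
    · intro y hy
      exact Finset.mem_sdiff.2 ⟨(Finset.mem_sdiff.1 hy).1,
        fun hyR => (Finset.mem_sdiff.1 hy).2 (hRT hyR)⟩
    · intro hsub
      obtain ⟨hxT, hxS⟩ := Finset.mem_inter.1 hx
      exact (Finset.mem_sdiff.1 (hsub hxS)).2 hxT
  · intro T hT
    simp only [Finset.mem_filter, Finset.mem_powerset] at hT
    exact Finset.sdiff_sdiff_eq_self (hT.1.trans Finset.sdiff_subset)
  · intro T hT
    simp only [Finset.mem_filter, Finset.mem_powerset] at hT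
    exact Finset.sdiff_sdiff_eq_self hT.1
  · intro T _
    rfl

/-- The injection `T ↦ T ∪ R` (`∪ S` when `T ∩ S = ∅`) of `{T ⊆ A ∖ R : ¬ S ⊆ T}` into
`{T' ⊆ A : R ⊆ T' ∧ T' ∩ S ≠ ∅}`, which contains `T`. -/
lemma sum_le_sum_corner (A R S : Finset α) (hR : R ⊆ A) (hS : S ⊆ A \ R)
    (G : Finset α → ℤ) (hmono : ∀ T T', T ⊆ T' → T' ⊆ A → G T ≤ G T')
    (hnonneg : ∀ T, 0 ≤ G T) :
    ∑ T ∈ (A \ R).powerset.filter (fun T => ¬ S ⊆ T), G T ≤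
      ∑ T ∈ A.powerset.filter (fun T => R ⊆ T ∧ (T ∩ S).Nonempty), G T := by
  set φ : Finset α → Finset α := fun T => if (T ∩ S).Nonempty then T ∪ R else T ∪ R ∪ S with hφ
  have hSA : S ⊆ A := hS.trans Finset.sdiff_subset
  have hRS : ∀ x ∈ S, x ∉ R := fun x hx => (Finset.mem_sdiff.1 (hS hx)).2
  have hmemI : ∀ T, T ∈ (A \ R).powerset.filter (fun T => ¬ S ⊆ T) ↔ T ⊆ A \ R ∧ ¬ S ⊆ T := by
    intro T; simp only [Finset.mem_filter, Finset.mem_powerset]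
  have hmemI' : ∀ T, T ∈ A.powerset.filter (fun T => R ⊆ T ∧ (T ∩ S).Nonempty) ↔
      T ⊆ A ∧ R ⊆ T ∧ (T ∩ S).Nonempty := by
    intro T; simp only [Finset.mem_filter, Finset.mem_powerset]
  -- `T ⊆ φ T ⊆ A` for `T ⊆ A ∖ R`
  have hsub : ∀ T, T ⊆ φ T := by
    intro T
    simp only [hφ]
    split_ifs
    · exact Finset.subset_union_left
    · exact Finset.subset_union_left.trans Finset.subset_union_left
  have hφA : ∀ T, T ⊆ A \ R → φ T ⊆ A := by
    intro T hT
    have hTA : T ⊆ A := hT.trans Finset.sdiff_subset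
    simp only [hφ]
    split_ifs
    · exact Finset.union_subset hTA hR
    · exact Finset.union_subset (Finset.union_subset hTA hR) hSA
  -- `φ` maps the index set into the target set
  have hmaps : ∀ T, T ⊆ A \ R → ¬ S ⊆ T → φ T ⊆ A ∧ R ⊆ φ T ∧ (φ T ∩ S).Nonempty := by
    intro T hTA hST
    refine ⟨hφA T hTA, ?_, ?_⟩
    · simp only [hφ]
      split_ifs
      · exact Finset.subset_union_right
      · exact Finset.subset_union_right.trans Finset.subset_union_left
    · simp only [hφ]
      split_ifs with hne
      · obtain ⟨x, hx⟩ := hne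
        exact ⟨x, Finset.mem_inter.2 ⟨Finset.mem_union_left _ (Finset.mem_inter.1 hx).1,
          (Finset.mem_inter.1 hx).2⟩⟩
      · obtain ⟨x, hxS, _⟩ := Finset.not_subset.1 hST
        exact ⟨x, Finset.mem_inter.2 ⟨Finset.mem_union_right _ hxS, hxS⟩⟩
  -- `S ⊆ φ T` iff `T ∩ S = ∅`
  have hcase : ∀ T, T ⊆ A \ R → ¬ S ⊆ T → (S ⊆ φ T ↔ ¬ (T ∩ S).Nonempty) := by
    intro T _ hST
    simp only [hφ]
    split_ifs with hne
    · simp only [hne, not_true_eq_false, iff_false]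
      intro hsub
      obtain ⟨x, hxS, hxT⟩ := Finset.not_subset.1 hST
      rcases Finset.mem_union.1 (hsub hxS) with h | h
      · exact hxT h
      · exact hRS x hxS h
    · simp only [hne, not_false_eq_true, iff_true]
      exact Finset.subset_union_right
  -- `φ` is injective on the index set
  have hinj : Set.InjOn φ (↑((A \ R).powerset.filter (fun T => ¬ S ⊆ T)) : Set (Finset α)) := by
    intro T₁ hT₁ T₂ hT₂ heq
    obtain ⟨hT₁A, hT₁S⟩ := (hmemI T₁).1 (Finset.mem_coe.1 hT₁)
    obtain ⟨hT₂A, hT₂S⟩ := (hmemI T₂).1 (Finset.mem_coe.1 hT₂)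
    have hTR₁ : ∀ x ∈ T₁, x ∉ R := fun x hx => (Finset.mem_sdiff.1 (hT₁A hx)).2
    have hTR₂ : ∀ x ∈ T₂, x ∉ R := fun x hx => (Finset.mem_sdiff.1 (hT₂A hx)).2
    have h1 := hcase T₁ hT₁A hT₁S
    have h2 := hcase T₂ hT₂A hT₂S
    rw [heq] at h1
    have hsame : (T₁ ∩ S).Nonempty ↔ (T₂ ∩ S).Nonempty := by
      rw [← not_iff_not, ← h1, ← h2]
    have heq' : (if (T₁ ∩ S).Nonempty then T₁ ∪ R else T₁ ∪ R ∪ S) =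
        (if (T₂ ∩ S).Nonempty then T₂ ∪ R else T₂ ∪ R ∪ S) := heq
    by_cases hne : (T₁ ∩ S).Nonempty
    · have hne₂ : (T₂ ∩ S).Nonempty := hsame.1 hne
      rw [if_pos hne, if_pos hne₂] at heq'
      ext x
      constructor
      · intro hx
        have : x ∈ T₂ ∪ R := heq' ▸ Finset.mem_union_left _ hx
        rcases Finset.mem_union.1 this with h | h
        · exact h
        · exact (hTR₁ x hx h).elim
      · intro hx
        have : x ∈ T₁ ∪ R := heq'.symm ▸ Finset.mem_union_left _ hx
        rcases Finset.mem_union.1 this with h | h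
        · exact h
        · exact (hTR₂ x hx h).elim
    · have hne₂ : ¬ (T₂ ∩ S).Nonempty := fun h => hne (hsame.2 h)
      rw [if_neg hne, if_neg hne₂] at heq'
      have hTS₁ : ∀ x ∈ T₁, x ∉ S := fun x hx hxS => hne ⟨x, Finset.mem_inter.2 ⟨hx, hxS⟩⟩
      have hTS₂ : ∀ x ∈ T₂, x ∉ S := fun x hx hxS => hne₂ ⟨x, Finset.mem_inter.2 ⟨hx, hxS⟩⟩
      ext x
      constructor
      · intro hx
        have : x ∈ T₂ ∪ R ∪ S := heq' ▸ Finset.mem_union_left _ (Finset.mem_union_left _ hx)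
        rcases Finset.mem_union.1 this with h | h
        · rcases Finset.mem_union.1 h with h' | h'
          · exact h'
          · exact (hTR₁ x hx h').elim
        · exact (hTS₁ x hx h).elim
      · intro hx
        have : x ∈ T₁ ∪ R ∪ S := heq'.symm ▸ Finset.mem_union_left _ (Finset.mem_union_left _ hx)
        rcases Finset.mem_union.1 this with h | h
        · rcases Finset.mem_union.1 h with h' | h'
          · exact h'
          · exact (hTR₂ x hx h').elim
        · exact (hTS₂ x hx h).elim
  calc ∑ T ∈ (A \ R).powerset.filter (fun T => ¬ S ⊆ T), G T
      ≤ ∑ T ∈ (A \ R).powerset.filter (fun T => ¬ S ⊆ T), G (φ T) :=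
        Finset.sum_le_sum (fun T hT => hmono T (φ T) (hsub T) (hφA T ((hmemI T).1 hT).1))
    _ = ∑ T ∈ ((A \ R).powerset.filter (fun T => ¬ S ⊆ T)).image φ, G T :=
        (Finset.sum_image hinj).symm
    _ ≤ ∑ T ∈ A.powerset.filter (fun T => R ⊆ T ∧ (T ∩ S).Nonempty), G T := by
        refine Finset.sum_le_sum_of_subset_of_nonneg ?_ (fun T _ _ => hnonneg T)
        intro T hT
        obtain ⟨T₀, hT₀, rfl⟩ := Finset.mem_image.1 hT
        obtain ⟨hT₀A, hT₀S⟩ := (hmemI T₀).1 hT₀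
        exact (hmemI' (φ T₀)).2 (hmaps T₀ hT₀A hT₀S)

/-- **The corner-free cube inequality** (pure combinatorics): for `R ⊆ A`, `S ⊆ A ∖ R` and a
monotone non-negative `G`, `Σ_{T ⊆ A ∖ R, ¬ S ⊆ T} (G T − G (A ∖ T)) ≤ 0`. -/
theorem sum_corner_nonpos (A R S : Finset α) (hR : R ⊆ A) (hS : S ⊆ A \ R)
    (G : Finset α → ℤ) (hmono : ∀ T T', T ⊆ T' → T' ⊆ A → G T ≤ G T')
    (hnonneg : ∀ T, 0 ≤ G T) :
    ∑ T ∈ (A \ R).powerset.filter (fun T => ¬ S ⊆ T), (G T - G (A \ T)) ≤ 0 := by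
  rw [Finset.sum_sub_distrib, sum_compl_corner A R S hR hS G, sub_nonpos]
  exact sum_le_sum_corner A R S hR hS G hmono hnonneg

end Combinatorics

section Count

variable [Fintype V] [DecidableEq V] [Fintype E] [DecidableEq E]

variable {ends : E → Sym2 V}

/-- The per-representative function `G` of the half-cube argument: `p ~_Y q` at the assignment
`T` of `ρ` and of its outside flip. -/
lemma G_mono_nonneg {p q : V} {H : Set V} {ρ : Config E} (hρ : ρ ∈ RepH ends p q H) :
    (∀ T T', T ⊆ T' → T' ⊆ compsH ends H ρ →
      ((if Conn ends (assignC ends T ρ) p q then (1 : ℤ) else 0) +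
        (if Conn ends (assignC ends T (flipOH ends H ρ)) p q then 1 else 0)) ≤
      ((if Conn ends (assignC ends T' ρ) p q then (1 : ℤ) else 0) +
        (if Conn ends (assignC ends T' (flipOH ends H ρ)) p q then 1 else 0))) ∧
    ∀ T, (0 : ℤ) ≤ (if Conn ends (assignC ends T ρ) p q then (1 : ℤ) else 0) +
        (if Conn ends (assignC ends T (flipOH ends H ρ)) p q then 1 else 0) := by
  have hρO := flipOH_mem_RepH hρ
  refine ⟨fun T T' hTT hT' => ?_, fun T => ?_⟩
  · have hT'O : T' ⊆ compsH ends H (flipOH ends H ρ) := by rw [compsH_flipOH]; exact hT'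
    exact add_le_add (ite_le_ite_of_imp (conn_pq_assignC_mono_H hρ hTT hT'))
      (ite_le_ite_of_imp (conn_pq_assignC_mono_H hρO hTT hT'O))
  · positivity

/-- **The corner-free half-cube inequality on a fibre**: for a representative `ρ`, a set `R`
of components and a set `S` of components disjoint from `R`,
`Σ_{T ⊆ compsH ρ ∖ R, ¬ S ⊆ T} (σ_pq(ρ_T) + σ_pq(ρ^O_T)) ≤ 0`. -/
theorem corner_sum_nonpos {p q : V} {H : Set V} {ρ : Config E} (hρ : ρ ∈ RepH ends p q H)
    {R S : Finset (Finset V)} (hR : R ⊆ compsH ends H ρ) (hS : S ⊆ compsH ends H ρ \ R) :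
    ∑ T ∈ (compsH ends H ρ \ R).powerset.filter (fun T => ¬ S ⊆ T),
      (sigma ends (assignC ends T ρ) p q +
        sigma ends (assignC ends T (flipOH ends H ρ)) p q) ≤ 0 := by
  set A := compsH ends H ρ with hA
  obtain ⟨hmono, hnonneg⟩ := G_mono_nonneg hρ
  have hterm : ∀ T ∈ (A \ R).powerset.filter (fun T => ¬ S ⊆ T),
      sigma ends (assignC ends T ρ) p q + sigma ends (assignC ends T (flipOH ends H ρ)) p q =
        ((if Conn ends (assignC ends T ρ) p q then (1 : ℤ) else 0) +
          (if Conn ends (assignC ends T (flipOH ends H ρ)) p q then 1 else 0)) -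
        ((if Conn ends (assignC ends (A \ T) ρ) p q then (1 : ℤ) else 0) +
          (if Conn ends (assignC ends (A \ T) (flipOH ends H ρ)) p q then 1 else 0)) := by
    intro T hT
    simp only [Finset.mem_filter, Finset.mem_powerset] at hT
    exact sigma_pq_add_flipOH_C hρ (hT.1.trans Finset.sdiff_subset)
  rw [Finset.sum_congr rfl hterm]
  exact sum_corner_nonpos A R S hR hS _ hmono hnonneg

end Count

end TermSwitch

end Summit.Ventures.PercRepro2
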